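import Literature.NumberTheory.Transcendental.KaehlerHodgeHarmonicProofs
import HarnessLib

/-!
# `ℋ^{p,q}_{∂̄} ≤ ℋᵏ_ℂ` on a Kähler manifold: corrected statement (holomorphic atlas as a binder)

`Literature/NumberTheory/Transcendental/KaehlerHodge.lean` (C12) renders the sentence after
Voisin's Corollary 6.10 (Hodge Theory and Complex Algebraic Geometry I, §6.1.2, p. 142: on a
Kähler manifold "`ℋ^{p,q}` … by theorem 6.7, is also equal to the set of forms of type `(p,q)` which
are harmonic for `Δ_∂̄`"; Thm. 6.7: `Δ_∂ = Δ_∂̄ = ½ Δ_d`) as the named fact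
`Literature.NumberTheory.Transcendental.dolbeaultHarmonicForms_le_charmonicForms g o`
(`ℋ^{p,q}_{∂̄} ≤ ℋᵏ_ℂ`: the `ℂ`-span of the smooth `∂̄`-harmonic `(p,q)`-forms lies in the `ℂ`-span of
the smooth `Δ_d`-harmonic complex `k`-forms). That `def … : Prop` is an M5 mechanical rewrite of a
sorried theorem and abstracts only the section variables its body uses: its binders are
`E, M, k, m, [FiniteDimensional ℂ E], n, [Fact (finrank ℝ E = n)], [IsManifold 𝓘(ℝ, E) ∞ M], g, o` —
the **holomorphic atlas** `[IsManifold 𝓘(ℂ, E) ω M]` of its section is *not* among them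
(`#check @dolbeaultHarmonicForms_le_charmonicForms`; the same defect as its parent fact
`cHodgeLaplacian_eq_two_smul_dolbeaultLaplacian`, see the *Correction* notes of `KaehlerHodge.lean`,
and as `typeComponent_mem_charmonicForms`, `isDolbeaultHarmonic_iff`,
`finite_dolbeaultHarmonicForms`). As elaborated it speaks about every real `C^∞` manifold charted
on `E`, where the "complex structure" `J_x = i •` of `TangentSpace 𝓘(ℝ, E) x = E` is read in the
preferred chart `chartAt x` of a merely smooth atlas, so that `IsOfType`, `∂̄ = dolbeaultBar` and
hence `Δ_∂̄` are not tensorial and the chart-wise exterior derivative inside `Δ_∂̄` returns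
Mathlib's junk value `0` on the resulting discontinuous representatives, while `Δ_d` (a real
operator) stays honest; in that generality the statement is false (on the torus `(ℝ/ℤ)²` charted on
`ℂ` by the `{id, conj}`-rigged atlas of `KaehlerHodgeDolbeaultHarmonicCounterexample.lean`, with its
flat — smooth, Kähler — metric, the smooth `(1,1)`-form `α = (F(x) · vol) ⊗ 1` of that file has
`Δ_∂̄ α = 0` but `Δ_d α = -F″(x) · vol ⊗ 1 ≠ 0`; kernel-checked refutation of the universal closure
of the old fact in the companion file `KaehlerHodgeHarmonicCounterexample.lean`, filed separately:
`not_dolbeaultHarmonicForms_le_charmonicForms`).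

This file records the **corrected statement**
`dolbeaultHarmonicForms_le_charmonicForms_of_isManifold_complex`, with the holomorphic atlas as an
explicit instance binder of the `def` (the pattern of
`cHodgeLaplacian_eq_two_smul_dolbeaultLaplacian_of_isManifold_complex`,
`typeComponent_mem_charmonicForms_of_isManifold_complex`,
`finite_dolbeaultHarmonicForms_of_isManifold`) and the body unchanged, the definitional `iff` with
the old `Prop` at a complex manifold, and its **proved reduction** to the corrected Kähler identity
`cHodgeLaplacian_eq_two_smul_dolbeaultLaplacian_of_isManifold_complex g o` (Voisin's Thm. 6.7), via
the glue `dolbeaultHarmonicForms_le_charmonicForms_of_laplacian_comparison` of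
`KaehlerHodgeHarmonicProofs.lean`. With a holomorphic atlas every ingredient (`IsOfType`,
`dolbeaultBar`, the `ℂ`-linear Hodge star of the smooth Kähler metric `g`, `dolbeaultLaplacian`,
`cHodgeLaplacian`) is the honest object and the statement is Voisin's remark; its proof is Thm. 6.7,
i.e. the Kähler identities `[Λ, ∂̄] = -i∂*`, `[Λ, ∂] = i∂̄*` (Prop. 6.5), not yet in `Literature/` —
it stays a named fact here, discharged the moment
`cHodgeLaplacian_eq_two_smul_dolbeaultLaplacian_of_isManifold_complex_holds` lands
(`dolbeaultHarmonicForms_le_charmonicForms_of_isManifold_complex_of_kaehlerIdentity`). The old def has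
no dependents.

## References

* C. Voisin, *Hodge Theory and Complex Algebraic Geometry I*, Cambridge Studies in Advanced
  Mathematics 76 (2002), §6.1.1 (Prop. 6.5), §6.1.2 (Thm. 6.7, Cor. 6.8–6.10 and the remark after
  Cor. 6.10, pp. 141–142).
* D. Huybrechts, *Complex Geometry* (2005), Prop. 3.1.12 (iii), §3.2 (Thm. 3.2.8, Cor. 3.2.12).
-/

noncomputable section

open scoped Manifold ContDiff Topology
open Bundle Module

namespace Literature.NumberTheory.Transcendental

variable {E : Type*} [NormedAddCommGroup E] [NormedSpace ℂ E]
  {M : Type*} [TopologicalSpace M] [ChartedSpace E M] {k m : ℕ}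
  [FiniteDimensional ℂ E] {n : ℕ} [Fact (finrank ℝ E = n)] [IsManifold 𝓘(ℝ, E) ∞ M]
  (g : ContMDiffRiemannianMetric 𝓘(ℝ, E) ∞ E (fun x : M ↦ TangentSpace 𝓘(ℝ, E) x))
  (o : (x : M) → Orientation ℝ (TangentSpace 𝓘(ℝ, E) x) (Fin n))

/-- **`ℋ^{p,q}_{∂̄} ≤ ℋᵏ_ℂ` on a Kähler manifold — corrected statement** (Voisin (2002), §6.1.2,
remark after Cor. 6.10, p. 142: on a Kähler manifold the space `ℋ^{p,q}` of `Δ_d`-harmonic forms of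
type `(p,q)` "by theorem 6.7, is also equal to the set of forms of type `(p,q)` which are harmonic
for `Δ_∂̄`"; Thm. 6.7: `Δ_∂ = Δ_∂̄ = ½ Δ_d`; Huybrechts (2005), §3.2). For a **complex** manifold `M`
(holomorphic atlas `[IsManifold 𝓘(ℂ, E) ω M]`, an explicit binder of this def), a smooth Riemannian
metric `g` on the real tangent bundle which is Kähler (`IsKaehler`), an orientation family `o` with
smooth volume form (`ho`; the Laplacians do not depend on `o`) and degrees `h : k + m = n`: the
`ℂ`-span `dolbeaultHarmonicForms o p q h` of the smooth `∂̄`-harmonic `(p,q)`-forms (`Δ_∂̄ α = 0`,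
`Δ_∂̄ = ∂̄∂̄* + ∂̄*∂̄`, `∂̄* = -⋆∂⋆`) is contained in the `ℂ`-span `charmonicForms o h` of the smooth
`Δ_d`-harmonic complex `k`-forms (`Δ_d = dδ + δd`, `δ = -⋆d⋆`). No compactness is needed (Thm. 6.7
is local). This corrects `Literature.NumberTheory.Transcendental.dolbeaultHarmonicForms_le_charmonicForms`,
whose `def` does not abstract the unused section instance `[IsManifold 𝓘(ℂ, E) ω M]` and is false
for general smooth real atlases (module docstring); same body otherwise
(`dolbeaultHarmonicForms_le_charmonicForms_of_isManifold_complex_iff`). Not proved here: the proof is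
Voisin's Thm. 6.7 (Kähler identities, Prop. 6.5), absent from the tree; it follows in one line from
the corrected Kähler identity `cHodgeLaplacian_eq_two_smul_dolbeaultLaplacian_of_isManifold_complex g o`
(`dolbeaultHarmonicForms_le_charmonicForms_of_isManifold_complex_of_kaehlerIdentity`).
[cite: Voisin2002, §6.1.2 Thm. 6.7 and remark after Cor. 6.10, p. 142] -/
def dolbeaultHarmonicForms_le_charmonicForms_of_isManifold_complex [IsManifold 𝓘(ℂ, E) ω M] :
    Prop :=
  ∀ (hg : g.toRiemannianMetric.IsKaehler) (h : k + m = n) (p q : ℕ),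
    letI : RiemannianBundle (fun x : M ↦ TangentSpace 𝓘(ℝ, E) x) := ⟨g.toRiemannianMetric⟩
    Literature.Geometry.Kaehler.IsSmoothForm (Literature.Geometry.Kaehler.riemannianVolumeForm o) →
      dolbeaultHarmonicForms o p q h ≤ charmonicForms o h

/-- At a complex manifold the corrected fact *is* the old `Prop`
`dolbeaultHarmonicForms_le_charmonicForms g o` (same body), so a discharge of either serves both.
[folklore] -/
theorem dolbeaultHarmonicForms_le_charmonicForms_of_isManifold_complex_iff
    [IsManifold 𝓘(ℂ, E) ω M] :
    dolbeaultHarmonicForms_le_charmonicForms_of_isManifold_complex (k := k) (m := m) g o ↔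
      dolbeaultHarmonicForms_le_charmonicForms (k := k) (m := m) g o :=
  Iff.rfl

/-- **The corrected fact from the corrected Kähler identity** (Voisin (2002), §6.1.2: the remark
after Cor. 6.10 is "by theorem 6.7"). If `Δ_d = 2Δ_∂̄` holds on the smooth forms of the Kähler
manifold `(M, g)` in degrees `k + m = n`
(`cHodgeLaplacian_eq_two_smul_dolbeaultLaplacian_of_isManifold_complex g o`), then
`ℋ^{p,q}_{∂̄} ≤ ℋᵏ_ℂ` in the same degrees: a smooth `(p,q)`-form with `Δ_∂̄ α = 0` has
`Δ_d α = 2 • 0 = 0`, so the generators of `dolbeaultHarmonicForms o p q h` lie in `charmonicForms o h`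
(`dolbeaultHarmonicForms_le_charmonicForms_of_laplacian_comparison`). Hence the corrected fact is
discharged by `cHodgeLaplacian_eq_two_smul_dolbeaultLaplacian_of_isManifold_complex_holds` as soon
as that lands. [cite: Voisin2002, §6.1.2 Thm. 6.7, remark after Cor. 6.10] -/
theorem dolbeaultHarmonicForms_le_charmonicForms_of_isManifold_complex_of_kaehlerIdentity
    [IsManifold 𝓘(ℂ, E) ω M]
    (hK : cHodgeLaplacian_eq_two_smul_dolbeaultLaplacian_of_isManifold_complex (k := k) (m := m) g o) :
    dolbeaultHarmonicForms_le_charmonicForms_of_isManifold_complex (k := k) (m := m) g o :=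
  dolbeaultHarmonicForms_le_charmonicForms_of_laplacian_comparison g o hK

end Literature.NumberTheory.Transcendental
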